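import Summits.Ventures.CertifiedManyBodySolver.Observables.StructureFactorsStripeTables

/-!
# Orientation-averaged stripe tables (M3-L1 follow-up to `StructureFactorsStripeTables`, seat m3-7 gen 3)

HONEST FRAMING: objects and exact identities only; no bound on any Hubbard state is claimed in
this file (first certified bounds are the programme; this is not a superconductivity verdict).

The certified TL rows of record bound the POINT-GROUP (D₄) orbit average of a correlator word
(`StructureFactorsAveraging.re_orbitState_fermionSpinDot_eq_sum_spinCorr_div`), so the row
functional that may be assembled from them is the one with a D₄-symmetric weight.  For the stripe
momenta this is the average over the two lattice orientations of the stripe: here the rotated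
(`y`-running) charge and spin stripe indices are defined, their closed-form tables are proved exactly
as in `StructureFactorsStripeTables`, and the orientation averages are put in closed form:

* charge: `(S_c(Q_c^x) + S_c(Q_c^y))/2 = ∑_r (cos (π r₀/4) + cos (π r₁/4))/2 · C_c(r)` on `8n × 8n`;
* spin:   `(S_s(Q_s^x) + S_s(Q_s^y))/2 = ∑_r (cos (7π r₀/8 + π r₁) + cos (π r₀ + 7π r₁/8))/2 · C_s(r)`
  on `16n × 16n`.

(`S(−k) = S(k)` is already manifest in the cosine form, so the two orientations exhaust the D₄ star.)
-/

namespace Summit.Ventures.CertifiedManyBodySolver.Observables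

open Literature.MathematicalPhysics.QuantumLattice Literature.Probability.LatticeModels
open scoped BigOperators

variable (L : ℕ) [NeZero L]

/-- The `y`-running period-8 CHARGE stripe momentum index `Q_c^y = (0, π/4) = 2π(0,1)/8` on `L = 8n`. -/
def stripeChargeIndexY (n : ℕ) : TorusSite 2 L := commMomentum L n ![0, 1]

/-- The `y`-running period-16 SPIN stripe momentum index `Q_s^y = (π, π − π/8) = 2π(8,7)/16` on `L = 16n`. -/
def stripeSpinIndexY (n : ℕ) : TorusSite 2 L := commMomentum L n ![8, 7]

/-- The rotated charge-stripe phase argument: `(0,1)·(r mod 8) = r₁.val (mod 8)`. -/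
theorem torusDot_stripeChargeY_reduce (r : TorusSite 2 L) :
    torusDot 8 (intMomentum 8 ![0, 1]) (reduceSite L 8 r) = (((r 1).val : ℕ) : ZMod 8) := by
  simp [torusDot, intMomentum, reduceSite, Fin.sum_univ_two]

/-- The rotated spin-stripe phase argument: `(8,7)·(r mod 16) = 8 r₀.val + 7 r₁.val (mod 16)`. -/
theorem torusDot_stripeSpinY_reduce (r : TorusSite 2 L) :
    torusDot 16 (intMomentum 16 ![8, 7]) (reduceSite L 16 r) =
      ((8 * (r 0).val + 7 * (r 1).val : ℕ) : ZMod 16) := by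
  simp [torusDot, intMomentum, reduceSite, Fin.sum_univ_two]

/-- Rotated charge-stripe weight in closed form: `cos (π r₁ / 4)`. -/
theorem cos_stripeChargeY_weight (r : TorusSite 2 L) :
    Real.cos (2 * Real.pi * ((torusDot 8 (intMomentum 8 ![0, 1]) (reduceSite L 8 r)).val : ℝ) / 8) =
      Real.cos (Real.pi * ((r 1).val : ℝ) / 4) := by
  rw [torusDot_stripeChargeY_reduce, ZMod.val_natCast]
  have h := cos_two_pi_mul_mod_div (r 1).val 8
  push_cast at h
  rw [h]
  congr 1
  ring

/-- Rotated spin-stripe weight in closed form: `cos (π r₀ + 7π r₁ / 8)`. -/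
theorem cos_stripeSpinY_weight (r : TorusSite 2 L) :
    Real.cos (2 * Real.pi * ((torusDot 16 (intMomentum 16 ![8, 7]) (reduceSite L 16 r)).val : ℝ) / 16) =
      Real.cos (Real.pi * ((r 0).val : ℝ) + 7 * Real.pi * ((r 1).val : ℝ) / 8) := by
  rw [torusDot_stripeSpinY_reduce, ZMod.val_natCast]
  have h := cos_two_pi_mul_mod_div (8 * (r 0).val + 7 * (r 1).val) 16
  push_cast at h
  rw [h]
  congr 1
  ring

/-- Rotated charge stripe row, uniform in `L` (raw `m`-periodic table form, as
`densityStructureFactor_stripeCharge`). -/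
theorem densityStructureFactor_stripeChargeY (n : ℕ) (hL : L = 8 * n)
    (ψ : Fock (Orb (FermionTorus 2 L))) :
    densityStructureFactor L (stripeChargeIndexY L n) ψ =
      ∑ r : TorusSite 2 L,
        Real.cos (2 * Real.pi * ((torusDot 8 (intMomentum 8 ![0, 1]) (reduceSite L 8 r)).val : ℝ) / 8)
          * densityCorr L r ψ := by
  exact densityStructureFactor_commMomentum L 8 n hL ![0, 1] ψ

/-- Rotated spin stripe row, uniform in `L` (raw table form, as `spinStructureFactor_stripeSpin`). -/
theorem spinStructureFactor_stripeSpinY (n : ℕ) (hL : L = 16 * n)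
    (ψ : Fock (Orb (FermionTorus 2 L))) :
    spinStructureFactor L (stripeSpinIndexY L n) ψ =
      ∑ r : TorusSite 2 L,
        Real.cos (2 * Real.pi * ((torusDot 16 (intMomentum 16 ![8, 7]) (reduceSite L 16 r)).val : ℝ) / 16)
          * spinCorr L r ψ := by
  exact spinStructureFactor_commMomentum L 16 n hL ![8, 7] ψ

/-- Rotated charge stripe row in closed form on every `8n × 8n` torus:
`S_c(Q_c^y; ψ) = ∑_r cos (π r₁/4) · C_c(r;ψ)`. -/
theorem densityStructureFactor_stripeChargeY_table (n : ℕ) (hL : L = 8 * n)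
    (ψ : Fock (Orb (FermionTorus 2 L))) :
    densityStructureFactor L (stripeChargeIndexY L n) ψ =
      ∑ r : TorusSite 2 L, Real.cos (Real.pi * ((r 1).val : ℝ) / 4) * densityCorr L r ψ := by
  rw [densityStructureFactor_stripeChargeY L n hL]
  refine Finset.sum_congr rfl fun r _ => ?_
  rw [cos_stripeChargeY_weight]

/-- Rotated spin stripe row in closed form on every `16n × 16n` torus:
`S_s(Q_s^y; ψ) = ∑_r cos (π r₀ + 7π r₁/8) · C_s(r;ψ)`. -/
theorem spinStructureFactor_stripeSpinY_table (n : ℕ) (hL : L = 16 * n)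
    (ψ : Fock (Orb (FermionTorus 2 L))) :
    spinStructureFactor L (stripeSpinIndexY L n) ψ =
      ∑ r : TorusSite 2 L, Real.cos (Real.pi * ((r 0).val : ℝ) + 7 * Real.pi * ((r 1).val : ℝ) / 8)
        * spinCorr L r ψ := by
  rw [spinStructureFactor_stripeSpinY L n hL]
  refine Finset.sum_congr rfl fun r _ => ?_
  rw [cos_stripeSpinY_weight]

/-- **Orientation-averaged charge stripe row** (the D₄-symmetric functional the orbit-averaged TL rows
can be assembled into), every `8n × 8n` torus, every state:
`(S_c(Q_c^x;ψ) + S_c(Q_c^y;ψ))/2 = ∑_r (cos (π r₀/4) + cos (π r₁/4))/2 · C_c(r;ψ)`. -/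
theorem densityStructureFactor_stripeCharge_orientAvg (n : ℕ) (hL : L = 8 * n)
    (ψ : Fock (Orb (FermionTorus 2 L))) :
    (densityStructureFactor L (stripeChargeIndex L n) ψ
        + densityStructureFactor L (stripeChargeIndexY L n) ψ) / 2 =
      ∑ r : TorusSite 2 L,
        (Real.cos (Real.pi * ((r 0).val : ℝ) / 4) + Real.cos (Real.pi * ((r 1).val : ℝ) / 4)) / 2
          * densityCorr L r ψ := by
  rw [densityStructureFactor_stripeCharge_table L n hL, densityStructureFactor_stripeChargeY_table L n hL,
    ← Finset.sum_add_distrib, Finset.sum_div]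
  refine Finset.sum_congr rfl fun r _ => ?_
  ring

/-- **Orientation-averaged spin stripe row**, every `16n × 16n` torus, every state:
`(S_s(Q_s^x;ψ) + S_s(Q_s^y;ψ))/2 = ∑_r (cos (7π r₀/8 + π r₁) + cos (π r₀ + 7π r₁/8))/2 · C_s(r;ψ)`. -/
theorem spinStructureFactor_stripeSpin_orientAvg (n : ℕ) (hL : L = 16 * n)
    (ψ : Fock (Orb (FermionTorus 2 L))) :
    (spinStructureFactor L (stripeSpinIndex L n) ψ
        + spinStructureFactor L (stripeSpinIndexY L n) ψ) / 2 =
      ∑ r : TorusSite 2 L,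
        (Real.cos (7 * Real.pi * ((r 0).val : ℝ) / 8 + Real.pi * ((r 1).val : ℝ))
            + Real.cos (Real.pi * ((r 0).val : ℝ) + 7 * Real.pi * ((r 1).val : ℝ) / 8)) / 2
          * spinCorr L r ψ := by
  rw [spinStructureFactor_stripeSpin_table L n hL, spinStructureFactor_stripeSpinY_table L n hL,
    ← Finset.sum_add_distrib, Finset.sum_div]
  refine Finset.sum_congr rfl fun r _ => ?_
  ring

end Summit.Ventures.CertifiedManyBodySolver.Observables
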